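import Mathlib

/-!
# The pure-phase zero-momentum witness: finite-dimensional skeleton (kernel K21)

Solo seat `solo-AtomisticToContinuum-blind`, conjunct `BoseEinsteinCondensation`; paper §11.7
(No-go F″-φ).  On the torus the state `Φ_A = e^{iA|ρ̂_k|}Ψ₀`, `ρ̂_k = Σ_j e^{ik·x_j} = u e^{iψ}`,
has the same modulus as the ground state, zero total momentum, exact excess energy
`A²k_L²⟨Σ_j sin²(k·x_j − ψ)⟩` and — conditionally on `x′ = (x₂,…,x_N)` — multiplies particle 1's
amplitude by a unimodular grating `T(θ₁) = e^{iA|1 + u′e^{i(θ₁−ψ′)}|}` with `Σ_m |T̂(m)|² = 1`, so that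
`⟨φ_p, Φ_A(·,x′)⟩ = Σ_m T̂(m) ĥ(p − mk)`.  This file checks the elementary facts the fragmentation
bound `λ_max(γ_Φ)/N ≤ 2π₀ + 2τ* + 2δ₀` is assembled from:

1. `one_add_sq_add_two_mul_cos` / `sq_mul_sin_sq_le` — `|1 + se^{iα}|² = (1 + s cos α)² + (s sin α)²`,
   hence `(s sin α)² ≤ 1 + s² + 2s cos α`, i.e. the radial function `R(α;s) = |1+se^{iα}|` has
   `|∂_α R| ≤ 1` (the Parseval tail `Σ_{|m|>M}|T̂(m)|² ≤ A²/M²`);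
2. `sum_sin_sub_phase_eq_zero` — `Σ_j sin(θ_j − ψ) = 0` when `Σ_j e^{iθ_j} = u e^{iψ}`, `u` real:
   the imprinted velocity field `A∇_j|ρ̂_k| = −Ak sin(θ_j − ψ)` carries zero total momentum;
3. `norm_sum_mul_sq_le_two` / `norm_sum_mul_sq_le_three` — the two Cauchy–Schwarz splits of
   `|Σ_m T̂(m) ĥ(p−mk)|²`: with `Σ‖T_m‖² ≤ 1`, `‖T_{m₀}‖² ≤ τ` (and `Σ_{m∉W}‖T_m‖² ≤ ε`),
   `‖Σ_m T_m h_m‖² ≤ 2τ‖h_{m₀}‖² + 2Σ_{m≠m₀}‖h_m‖²` and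
   `‖Σ_m T_m h_m‖² ≤ 3τ‖h_{m₀}‖² + 3Σ_{m∈W∖m₀}‖h_m‖² + 3εΣ_m‖h_m‖²`;
4. `discrete_groundState_repr_complex` — the ground-state representation on a weighted graph for a
   COMPLEX multiplier: `⟨Fψ,(−W+U−E)(Fψ)⟩ = ½ Σ_{x,y} w_{xy} ψ_x ψ_y |F_x − F_y|²` (the real case is in
   `SoloBlindZeroMomentumImprint`); with `|F| = 1` this is the exact-energy identity of the witness on
   a lattice, and its nonnegativity `discrete_groundState_form_complex_nonneg`.

Only Mathlib is used; no definitions are introduced.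
-/

noncomputable section

open Finset
open scoped Real ComplexConjugate BigOperators

namespace Summit.AtomisticToContinuum.BoseEinsteinCondensation.Theorems

/-! ## 1. The radial function `|1 + s e^{iα}|` is 1-Lipschitz in the angle -/

/-- `|1 + s e^{iα}|² = 1 + s² + 2s cos α = (1 + s cos α)² + (s sin α)²`. -/
theorem one_add_sq_add_two_mul_cos (s α : ℝ) :
    1 + s ^ 2 + 2 * s * Real.cos α = (1 + s * Real.cos α) ^ 2 + (s * Real.sin α) ^ 2 := by
  have h := Real.sin_sq_add_cos_sq α
  have h3 : (s * Real.sin α) ^ 2 = s ^ 2 * (1 - Real.cos α ^ 2) := by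
    rw [← h]; ring
  rw [h3]; ring

/-- The numerator of `(∂_α R)² = s² sin²α / R²` is at most `R² = 1 + s² + 2s cos α`: `|∂_α R| ≤ 1`. -/
theorem sq_mul_sin_sq_le (s α : ℝ) :
    s ^ 2 * Real.sin α ^ 2 ≤ 1 + s ^ 2 + 2 * s * Real.cos α := by
  rw [one_add_sq_add_two_mul_cos]
  nlinarith [sq_nonneg (1 + s * Real.cos α), sq_nonneg (s * Real.sin α)]

/-- Quotient form: wherever `R² = 1 + s² + 2 s cos α > 0`, `(s sin α)² / R² ≤ 1`. -/
theorem radialDeriv_sq_le_one (s α : ℝ) (hR : 0 < 1 + s ^ 2 + 2 * s * Real.cos α) :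
    (s * Real.sin α) ^ 2 / (1 + s ^ 2 + 2 * s * Real.cos α) ≤ 1 := by
  rw [div_le_one hR, mul_pow]
  exact sq_mul_sin_sq_le s α

/-! ## 2. Zero total momentum of the imprinted flow -/

/-- If `Σ_l e^{iθ_l} = u e^{iψ}` with `u` real, then `Σ_j sin(θ_j − ψ) = 0`. -/
theorem sum_sin_sub_phase_eq_zero {ι : Type*} (s : Finset ι) (θ : ι → ℝ) (u ψ : ℝ)
    (hρ : ∑ l ∈ s, Complex.exp (θ l * Complex.I) = u * Complex.exp (ψ * Complex.I)) :
    ∑ j ∈ s, Real.sin (θ j - ψ) = 0 := by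
  have h1 : ∀ j, Real.sin (θ j - ψ) =
      (Complex.exp (θ j * Complex.I) * Complex.exp (-(ψ * Complex.I))).im := by
    intro j
    rw [← Complex.exp_add]
    have : (θ j : ℂ) * Complex.I + -(ψ * Complex.I) = ((θ j - ψ : ℝ) : ℂ) * Complex.I := by
      push_cast; ring
    rw [this, Complex.exp_ofReal_mul_I_im]
  simp_rw [h1]
  rw [← Complex.im_sum, ← Finset.sum_mul, hρ, mul_assoc, ← Complex.exp_add]
  simp

/-! ## 3. The Cauchy–Schwarz splits of the fibre identity -/

/-- Cauchy–Schwarz for a finite sum of products of complex numbers, in squared-norm form. -/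
theorem norm_sum_mul_sq_le_mul {ι : Type*} (t : Finset ι) (T h : ι → ℂ) :
    ‖∑ m ∈ t, T m * h m‖ ^ 2 ≤ (∑ m ∈ t, ‖T m‖ ^ 2) * ∑ m ∈ t, ‖h m‖ ^ 2 := by
  calc ‖∑ m ∈ t, T m * h m‖ ^ 2 ≤ (∑ m ∈ t, ‖T m‖ * ‖h m‖) ^ 2 := by
        gcongr
        exact (norm_sum_le _ _).trans (le_of_eq (Finset.sum_congr rfl fun m _ => norm_mul _ _))
    _ ≤ (∑ m ∈ t, ‖T m‖ ^ 2) * ∑ m ∈ t, ‖h m‖ ^ 2 := Finset.sum_mul_sq_le_sq_mul_sq t _ _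

/-- Two-term split (the crude bound): if `Σ_m ‖T_m‖² ≤ 1` and `‖T_{m₀}‖² ≤ τ` then
`‖Σ_m T_m h_m‖² ≤ 2τ‖h_{m₀}‖² + 2 Σ_{m ≠ m₀} ‖h_m‖²`. -/
theorem norm_sum_mul_sq_le_two {ι : Type*} [DecidableEq ι] (s : Finset ι) {m₀ : ι} (hm₀ : m₀ ∈ s)
    (T h : ι → ℂ) {τ : ℝ} (hτ : ‖T m₀‖ ^ 2 ≤ τ) (hT1 : ∑ m ∈ s, ‖T m‖ ^ 2 ≤ 1) :
    ‖∑ m ∈ s, T m * h m‖ ^ 2 ≤ 2 * (τ * ‖h m₀‖ ^ 2) + 2 * ∑ m ∈ s.erase m₀, ‖h m‖ ^ 2 := by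
  have hsplit : ∑ m ∈ s, T m * h m = T m₀ * h m₀ + ∑ m ∈ s.erase m₀, T m * h m :=
    (Finset.add_sum_erase s _ hm₀).symm
  set a := ‖T m₀ * h m₀‖ with ha_def
  set b := ‖∑ m ∈ s.erase m₀, T m * h m‖ with hb_def
  have htri : ‖∑ m ∈ s, T m * h m‖ ≤ a + b := by
    rw [hsplit]; exact norm_add_le _ _
  have ha : a ^ 2 ≤ τ * ‖h m₀‖ ^ 2 := by
    rw [ha_def, norm_mul, mul_pow]
    exact mul_le_mul_of_nonneg_right hτ (sq_nonneg _)
  have hb : b ^ 2 ≤ ∑ m ∈ s.erase m₀, ‖h m‖ ^ 2 := by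
    have h1 : ∑ m ∈ s.erase m₀, ‖T m‖ ^ 2 ≤ 1 :=
      (Finset.sum_le_sum_of_subset_of_nonneg (s.erase_subset m₀) (fun _ _ _ => sq_nonneg _)).trans hT1
    have h0 : 0 ≤ ∑ m ∈ s.erase m₀, ‖h m‖ ^ 2 := Finset.sum_nonneg fun _ _ => sq_nonneg _
    calc b ^ 2 ≤ (∑ m ∈ s.erase m₀, ‖T m‖ ^ 2) * ∑ m ∈ s.erase m₀, ‖h m‖ ^ 2 :=
          norm_sum_mul_sq_le_mul _ _ _
      _ ≤ 1 * ∑ m ∈ s.erase m₀, ‖h m‖ ^ 2 := mul_le_mul_of_nonneg_right h1 h0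
      _ = _ := one_mul _
  have hab : 0 ≤ a + b := add_nonneg (norm_nonneg _) (norm_nonneg _)
  calc ‖∑ m ∈ s, T m * h m‖ ^ 2 ≤ (a + b) ^ 2 := by
        gcongr
    _ ≤ 2 * (a ^ 2 + b ^ 2) := by nlinarith [sq_nonneg (a - b)]
    _ ≤ _ := by linarith

/-- Three-term split (the window bound): if moreover `Σ_{m ∈ s∖W} ‖T_m‖² ≤ ε` (the Parseval tail)
and `m₀ ∈ W ⊆ s`, then
`‖Σ_m T_m h_m‖² ≤ 3τ‖h_{m₀}‖² + 3 Σ_{m ∈ W∖m₀} ‖h_m‖² + 3ε Σ_m ‖h_m‖²`. -/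
theorem norm_sum_mul_sq_le_three {ι : Type*} [DecidableEq ι] (s W : Finset ι) (hW : W ⊆ s)
    {m₀ : ι} (hm₀ : m₀ ∈ W) (T h : ι → ℂ) {τ ε : ℝ}
    (hτ : ‖T m₀‖ ^ 2 ≤ τ) (hT1 : ∑ m ∈ s, ‖T m‖ ^ 2 ≤ 1)
    (hTε : ∑ m ∈ s \ W, ‖T m‖ ^ 2 ≤ ε) :
    ‖∑ m ∈ s, T m * h m‖ ^ 2 ≤
      3 * (τ * ‖h m₀‖ ^ 2) + 3 * ∑ m ∈ W.erase m₀, ‖h m‖ ^ 2 + 3 * (ε * ∑ m ∈ s, ‖h m‖ ^ 2) := by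
  have hsplit : ∑ m ∈ s, T m * h m =
      T m₀ * h m₀ + ∑ m ∈ W.erase m₀, T m * h m + ∑ m ∈ s \ W, T m * h m := by
    rw [← Finset.sum_sdiff hW, ← Finset.add_sum_erase W _ hm₀]; ring
  set a := ‖T m₀ * h m₀‖ with ha_def
  set b := ‖∑ m ∈ W.erase m₀, T m * h m‖ with hb_def
  set c := ‖∑ m ∈ s \ W, T m * h m‖ with hc_def
  have htri : ‖∑ m ∈ s, T m * h m‖ ≤ a + b + c := by
    rw [hsplit]
    exact norm_add₃_le
  have ha : a ^ 2 ≤ τ * ‖h m₀‖ ^ 2 := by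
    rw [ha_def, norm_mul, mul_pow]
    exact mul_le_mul_of_nonneg_right hτ (sq_nonneg _)
  have hb : b ^ 2 ≤ ∑ m ∈ W.erase m₀, ‖h m‖ ^ 2 := by
    have h1 : ∑ m ∈ W.erase m₀, ‖T m‖ ^ 2 ≤ 1 :=
      (Finset.sum_le_sum_of_subset_of_nonneg ((W.erase_subset m₀).trans hW)
        (fun _ _ _ => sq_nonneg _)).trans hT1
    have h0 : 0 ≤ ∑ m ∈ W.erase m₀, ‖h m‖ ^ 2 := Finset.sum_nonneg fun _ _ => sq_nonneg _
    calc b ^ 2 ≤ (∑ m ∈ W.erase m₀, ‖T m‖ ^ 2) * ∑ m ∈ W.erase m₀, ‖h m‖ ^ 2 :=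
          norm_sum_mul_sq_le_mul _ _ _
      _ ≤ 1 * ∑ m ∈ W.erase m₀, ‖h m‖ ^ 2 := mul_le_mul_of_nonneg_right h1 h0
      _ = _ := one_mul _
  have hε : 0 ≤ ε := (Finset.sum_nonneg fun _ _ => sq_nonneg _).trans hTε
  have hc : c ^ 2 ≤ ε * ∑ m ∈ s, ‖h m‖ ^ 2 := by
    have h2 : ∑ m ∈ s \ W, ‖h m‖ ^ 2 ≤ ∑ m ∈ s, ‖h m‖ ^ 2 :=
      Finset.sum_le_sum_of_subset_of_nonneg Finset.sdiff_subset (fun _ _ _ => sq_nonneg _)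
    have h0 : 0 ≤ ∑ m ∈ s \ W, ‖h m‖ ^ 2 := Finset.sum_nonneg fun _ _ => sq_nonneg _
    calc c ^ 2 ≤ (∑ m ∈ s \ W, ‖T m‖ ^ 2) * ∑ m ∈ s \ W, ‖h m‖ ^ 2 :=
          norm_sum_mul_sq_le_mul _ _ _
      _ ≤ ε * ∑ m ∈ s, ‖h m‖ ^ 2 := mul_le_mul hTε h2 h0 hε
  calc ‖∑ m ∈ s, T m * h m‖ ^ 2 ≤ (a + b + c) ^ 2 := by
        gcongr
    _ ≤ 3 * (a ^ 2 + b ^ 2 + c ^ 2) := by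
        nlinarith [sq_nonneg (a - b), sq_nonneg (b - c), sq_nonneg (a - c)]
    _ ≤ _ := by linarith

/-! ## 4. The ground-state representation on a weighted graph, complex multiplier -/

/-- Discrete ground-state representation for a COMPLEX multiplier `F`: for a symmetric real
hopping matrix `w`, a real potential `U` and a real eigenvector `ψ` (`−Σ_y w_{xy}ψ_y + U_xψ_x = Eψ_x`),
`⟨Fψ, (−W + U − E)(Fψ)⟩ = ½ Σ_{x,y} w_{xy} ψ_x ψ_y |F_x − F_y|²`. -/
theorem discrete_groundState_repr_complex {V : Type*} [Fintype V] (w : V → V → ℝ)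
    (hw : ∀ x y, w x y = w y x) (U ψ : V → ℝ) (F : V → ℂ) (E : ℝ)
    (hψ : ∀ x, -∑ y, w x y * ψ y + U x * ψ x = E * ψ x) :
    ∑ x, conj (F x * ψ x) *
        ((-∑ y, (w x y : ℂ) * (F y * ψ y) + (U x : ℂ) * (F x * ψ x)) - (E : ℂ) * (F x * ψ x)) =
      (1 / 2 : ℂ) * ∑ x, ∑ y, (w x y : ℂ) * ψ x * ψ y * (Complex.normSq (F x - F y) : ℂ) := by
  -- the eigenvalue equation, cast to `ℂ`
  have hψ' : ∀ x, (E : ℂ) * ψ x = -∑ y, (w x y : ℂ) * ψ y + (U x : ℂ) * ψ x := by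
    intro x
    have h := congrArg (fun r : ℝ => (r : ℂ)) (hψ x)
    push_cast at h
    exact h.symm
  -- pointwise: substitute the eigenvalue equation
  have key : ∀ x, conj (F x * ψ x) *
      ((-∑ y, (w x y : ℂ) * (F y * ψ y) + (U x : ℂ) * (F x * ψ x)) - (E : ℂ) * (F x * ψ x)) =
      ∑ y, (w x y : ℂ) * ψ x * ψ y * (conj (F x) * (F x - F y)) := by
    intro x
    have hE : (E : ℂ) * (F x * ψ x) = F x * (-∑ y, (w x y : ℂ) * ψ y + (U x : ℂ) * ψ x) := by
      rw [← hψ' x]; ring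
    rw [hE, map_mul, Complex.conj_ofReal]
    have : (-∑ y, (w x y : ℂ) * (F y * ψ y) + (U x : ℂ) * (F x * ψ x)) -
        F x * (-∑ y, (w x y : ℂ) * ψ y + (U x : ℂ) * ψ x) =
        ∑ y, (w x y : ℂ) * ψ y * (F x - F y) := by
      have h1 : ∑ y, (w x y : ℂ) * ψ y * (F x - F y) =
          F x * ∑ y, (w x y : ℂ) * ψ y - ∑ y, (w x y : ℂ) * (F y * ψ y) := by
        rw [Finset.mul_sum, ← Finset.sum_sub_distrib]
        refine Finset.sum_congr rfl fun y _ => by ring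
      rw [h1]; ring
    rw [this, Finset.mul_sum]
    refine Finset.sum_congr rfl fun y _ => by ring
  simp_rw [key]
  -- symmetrise the double sum
  set a : V → V → ℂ := fun x y => (w x y : ℂ) * ψ x * ψ y * (conj (F x) * (F x - F y)) with ha
  have hcomm : ∑ x, ∑ y, a x y = ∑ x, ∑ y, a y x := Finset.sum_comm
  have hsum : ∑ x, ∑ y, a x y = (1 / 2 : ℂ) * ∑ x, ∑ y, (a x y + a y x) := by
    have : ∑ x, ∑ y, (a x y + a y x) = ∑ x, ∑ y, a x y + ∑ x, ∑ y, a y x := by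
      rw [← Finset.sum_add_distrib]
      refine Finset.sum_congr rfl fun x _ => Finset.sum_add_distrib
    rw [this, ← hcomm]; ring
  change ∑ x, ∑ y, a x y = _
  rw [hsum]
  congr 1
  refine Finset.sum_congr rfl fun x _ => Finset.sum_congr rfl fun y _ => ?_
  simp only [ha]
  rw [hw y x, Complex.normSq_eq_conj_mul_self, map_sub]
  ring

/-- Consequence: with nonnegative hoppings and a nonnegative eigenvector the deformed form is real
and `≥ 0`; for a unimodular multiplier it is bounded by `½ Σ w ψψ · 4 = 2 Σ w ψ ψ` whatever `F` is,
and equals `½ Σ_{x,y} w_{xy}ψ_xψ_y |F_x − F_y|²` exactly (the lattice exact-energy identity). -/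
theorem discrete_groundState_form_complex_nonneg {V : Type*} [Fintype V] (w : V → V → ℝ)
    (hw : ∀ x y, w x y = w y x) (hw0 : ∀ x y, 0 ≤ w x y) (U ψ : V → ℝ) (hψ0 : ∀ x, 0 ≤ ψ x)
    (F : V → ℂ) (E : ℝ) (hψ : ∀ x, -∑ y, w x y * ψ y + U x * ψ x = E * ψ x) :
    0 ≤ (∑ x, conj (F x * ψ x) *
        ((-∑ y, (w x y : ℂ) * (F y * ψ y) + (U x : ℂ) * (F x * ψ x)) - (E : ℂ) * (F x * ψ x))).re := by
  rw [discrete_groundState_repr_complex w hw U ψ F E hψ]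
  have : (1 / 2 : ℂ) * ∑ x, ∑ y, (w x y : ℂ) * ψ x * ψ y * (Complex.normSq (F x - F y) : ℂ) =
      ((1 / 2 * ∑ x, ∑ y, w x y * ψ x * ψ y * Complex.normSq (F x - F y) : ℝ) : ℂ) := by
    push_cast; rfl
  rw [this, Complex.ofReal_re]
  refine mul_nonneg (by norm_num) (Finset.sum_nonneg fun x _ => Finset.sum_nonneg fun y _ => ?_)
  have := hw0 x y; have := hψ0 x; have := hψ0 y; have := Complex.normSq_nonneg (F x - F y)
  positivity

end Summit.AtomisticToContinuum.BoseEinsteinCondensation.Theorems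

end
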